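import Literature.MathematicalPhysics.QuantumFieldTheory.Balaban1983to89.B4Eq242SignedImages

/-!
# `Balaban1983to89.B4Eq242SignedImagesFold` — [Balaban1983RegularityDecay] (2.42) p. 584, THE MULTIPLE REFLECTION METHOD FOR NON-LOCAL LETTERS: THE SIGNED IMAGE
# FOLD IS MULTIPLICATIVE — `fold(M·N) = fold(M)·fold(N)` on the interior of a mirror box whenever `N` is reflection-invariant, the images of the interior TILE the
# free sites and the mirror rows cancel — hence the compression of a product of reflection-invariant letters (e.g. [Balaban1985BackgroundPropagators] (3.25)
# `Q′G′_□²Q′*` of the cube sequence with the Dirichlet `G′_□`) is inverted EXACTLY by the fold of the inverse on the covering torus (file D1′ of ROAD (I) «IMAGES»)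

statement-level skeleton of published theorems with citation tags; proofs where landed; nothing here is a claim about the Yang–Mills mass gap

CITATION HEADER (lean-in-tree rule).  [B4] = T. Bałaban, *Regularity and decay of lattice Green's functions*, Commun. Math. Phys. **89** (1983) 571–597
[`Balaban1983RegularityDecay`], (2.42) p. 584 («We represent G_j(□) with the help of the propagator G_j with free boundary conditions on ξZ^d using the multiple
reflection method … Using this representation it is enough to prove (2.35), (2.36) for the propagator G_j»).  [B9] = T. Bałaban, *Propagators for lattice gauge
theories in a background field*, Commun. Math. Phys. **99** (1985) 389–434 [`Balaban1985BackgroundPropagators`], p. 394 («All operators we will consider will be defined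
by using Dirichlet boundary conditions on Ω₀»), (3.25) p. 394 (`R = I − G′Q′*(Q′G′²Q′*)⁻¹Q′G′`), Thm 3.2 (3.48) p. 398, p. 409 l. 1–5 («C_□(U) = (Q′(U)G′_□²(U)Q′*(U))⁻¹
… satisfy all the inequalities of Theorems 3.1–3.3»).  [4] = [`Balaban1984PropagatorsII`] Prop. 2.3 (2.87)–(2.88) p. 238.

WHY THIS FILE (cell `pub-ymgap`, node N06, seat dag-n06-c g33; road (B5) of director-ym №606 and this seat's ROAD (I)).  File D1 (`B4Eq242SignedImages`, g31) inverts the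
compression of a LOCAL reflection-invariant operator `A` (its exterior couplings reach only the mirror planes) by the signed image kernel of `A⁻¹` — enough for
the Dirichlet SITE letter `G′_□(1) = (Ω₀Δ′_{a,□}Ω₀)⁻¹`.  The bond chain's next `U = 1` input, Theorem 3.2 for print's Dirichlet `C_□(1) = (Q′G′_□(1)²Q′*)⁻¹` on the blocks
inside `Ω₀(□)` (r05's torus twin `B9Thm31CubeLocalFlat.thm32_cubeW_flat`, the ONE flat input of the (3.76)–(3.77) `P₁`-word `B9Cor35POneAtCubeLetters.cor35_POne_cube` not yet
at the Dirichlet letter), is the inverse of a compression of a NON-LOCAL word, to which D1's locality hypothesis (d) does not apply.  The odd-sector form of the method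
of images does: the fold `M ↦ (x, y) ↦ Σ_σ sgn(σ)·M(x, σy)` is MULTIPLICATIVE across a middle carrier whose free points are tiled by the images of the interior and whose
mirror points cancel (§2), so `fold(Q̂′)·fold(Ĝ)·fold(Ĝ)·fold(Q̂′*) = fold(Q̂′Ĝ²Q̂′*)` and `fold(X̂)·fold(X̂⁻¹) = fold(1) = 1` (§3).  THIS FILE is the model-free linear
algebra (three carriers, rectangular letters); the geometry (block reflections of g31's reflected cube family, the tiling of the doubled torus's sites and blocks by
the images of `Ω₀(□)` and of the blocks inside it, the mirror cancellations) is the next file's.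

WHAT IS PROVED (1 `def` with body — `foldK`; theorems; 0 sorry; 0 new named facts; standard axioms).  Finite index types, a commutative ring `R`, an index type `ι`
of images with `Γ : Finset ι`, signs `s : ι → R`, per-carrier actions `σ_k : ι → Perm Y_k`:
* §1 `foldK Γ σ s M x y := Σ_{i∈Γ} s_i·M x (σ_i y)` (rectangular; D1's `signedImK` is the square case, `foldK_eq_signedImK`), `foldK_apply`.
* §2 ★★★ `sum_foldK_mul_foldK` — THE FOLD IS MULTIPLICATIVE: under (closure) `Γ` closed under an index product `mul` compatible with `σ₃` and the signs, `mul i` a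
  bijection of `Γ`; (invariance) `N (σ₂ᵢu) (σ₃ᵢw) = N u w`; (tiling) `(i, z) ↦ σ₂ᵢz` injective on `Γ × X₂`; (cancellation) `Σ_i s_i N w (σ₃ᵢy) = 0` at every `w` off
  the image of `Γ × X₂`: `Σ_{z∈X₂} foldK M x z · foldK N z y = foldK (M·N) x y`.
* §3 ★ `foldK_one_apply` (freeness ⇒ `fold(1) = 1` on `X`), ★★ `compress_foldK_mul` (the compressions multiply: `fold(M)|·fold(N)| = fold(MN)|`),
  ★★★ `compress_foldK_mul_compress_foldK_eq_one` ∕ `isUnit_compress_foldK` ∕ `inv_compress_foldK` (for `A·G = 1` with `G` invariant: `fold(A)|_{X} · fold(G)|_{X} = 1`,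
  so the compression of the folded letter is a unit with inverse the compressed fold of the inverse).
* §4 ★ `abs_foldK_le_of_antitone` (the decay fold, D1 §4 rectangular: `|fold(G) x y| ≤ #Γ·c(x)·φ(d(x,y))` when `|G u w| ≤ c(u)φ(d′(u,w))`, `φ` antitone and
  `d(x,y) ≤ d′(x, σ_i y)`).

HONEST SCOPE / NOT CLAIMED.  Abstract linear algebra; no lattice, no reflection group is constructed (the instance supplies `ι = Fin (d+1) → Bool`, `mul = xor`,
`s = (−1)^{#ε}`, the site and block reflections of the doubled torus, and checks tiling ∕ cancellation ∕ freeness); no bound of [B4]/[4]/[B9] is proved or asserted.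
Count-neutral; N06 NOT discharged; nothing on `d = 4`, the continuum, reflection positivity, the mass gap or Clay.  No `sorry`, no `axiom`, no `instance`, no
`notation`.  Seat `pub-ymgap-dag-n06-c` g33, 2026-08-31; `--supports stmt-QuantumFields-27239`.

RELATED IN THE TREE, NOT DUPLICATED: D1 `B4Eq242SignedImages` (LOCAL letters: `compress_mul_signedImK` under the mirror-locality hypothesis (d); §2's cancellation lemma
`sum_sign_mul_apply_perm_eq_zero` is what instances use to discharge this file's cancellation hypothesis), `B4Reflection242` (unsigned Neumann images, infinite source),
g31's D2–D3 (`B6MultiLevelTorusMirror*`: the geometry this engine will be instantiated on).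
-/

namespace Literature.MathematicalPhysics.QuantumFieldTheory.Balaban1983to89.B4Eq242SignedImagesFold

open Finset
open Literature.MathematicalPhysics.QuantumFieldTheory.Balaban1983to89.B4Eq242SignedImages (signedImK)

variable {Y₁ Y₂ Y₃ : Type*} {R : Type*} {ι : Type*}

/-! ## §1  The rectangular signed image fold -/

section Fold

variable [CommRing R]

/-- **THE SIGNED IMAGE FOLD of a rectangular kernel**: `fold(M)(x, y) = Σ_{i∈Γ} s_i · M(x, σ_i y)` (the images act on the TARGET carrier).
[cite: Balaban1983RegularityDecay, (2.42) p.584; Balaban1985BackgroundPropagators, p.394 (Dirichlet boundary conditions on ∂Ω₀)] -/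
def foldK (Γ : Finset ι) (σ : ι → Equiv.Perm Y₂) (s : ι → R) (M : Matrix Y₁ Y₂ R) : Matrix Y₁ Y₂ R :=
  fun x y => ∑ i ∈ Γ, s i * M x (σ i y)

/-- the entries of the fold. [cite: Balaban1983RegularityDecay, (2.42) p.584, dictionary] -/
theorem foldK_apply (Γ : Finset ι) (σ : ι → Equiv.Perm Y₂) (s : ι → R) (M : Matrix Y₁ Y₂ R) (x : Y₁) (y : Y₂) :
    foldK Γ σ s M x y = ∑ i ∈ Γ, s i * M x (σ i y) := rfl

/-- the square fold IS D1's signed image kernel. [cite: Balaban1983RegularityDecay, (2.42) p.584, dictionary] -/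
theorem foldK_eq_signedImK (Γ : Finset ι) (σ : ι → Equiv.Perm Y₂) (s : ι → R) (G : Matrix Y₂ Y₂ R) : foldK Γ σ s G = signedImK Γ σ s G := rfl

end Fold

/-! ## §2  ★★★ The fold is multiplicative across a tiled middle carrier -/

section Mul

variable [CommRing R] [Fintype Y₂] [DecidableEq Y₂]

/-- ★★★ **THE FOLD IS MULTIPLICATIVE** (the odd-sector form of the method of images): for `M : Y₁ × Y₂`, `N : Y₂ × Y₃`, images acting on `Y₂` by `σ₂` and on `Y₃` by `σ₃`,
IF `Γ` is closed under an index product `mul` with `σ₃ (mul i j) = σ₃ i ∘ σ₃ j`, `s (mul i j) = s i · s j` and `mul i` a bijection of `Γ` (closure), `N` is jointly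
invariant (`N (σ₂ᵢ u) (σ₃ᵢ w) = N u w`), the images of the interior `X₂` are pairwise distinct (`(i, z) ↦ σ₂ᵢ z` injective on `Γ × X₂` — tiling), and at every middle
point NOT of that form the signed image sum of the rows of `N` vanishes (mirror cancellation), THEN `Σ_{z∈X₂} fold(M)(x, z)·fold(N)(z, y) = fold(M·N)(x, y)`.
[cite: Balaban1983RegularityDecay, (2.42) p.584 («Using this representation it is enough to prove (2.35), (2.36) for the propagator G_j»); Balaban1985BackgroundPropagators, p.394, (3.25) p.394] -/
theorem sum_foldK_mul_foldK (Γ : Finset ι) (s : ι → R) (σ₂ : ι → Equiv.Perm Y₂) (σ₃ : ι → Equiv.Perm Y₃) (mul : ι → ι → ι) (X₂ : Finset Y₂)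
    (hmem : ∀ i ∈ Γ, ∀ j ∈ Γ, mul i j ∈ Γ) (hσ₃ : ∀ i ∈ Γ, ∀ j ∈ Γ, σ₃ (mul i j) = σ₃ i * σ₃ j) (hs : ∀ i ∈ Γ, ∀ j ∈ Γ, s (mul i j) = s i * s j)
    (hbij : ∀ i ∈ Γ, Set.BijOn (mul i) ↑Γ ↑Γ)
    {N : Matrix Y₂ Y₃ R} (hN : ∀ i ∈ Γ, ∀ u w, N (σ₂ i u) (σ₃ i w) = N u w)
    (htile : ∀ i ∈ Γ, ∀ j ∈ Γ, ∀ z ∈ X₂, ∀ z' ∈ X₂, σ₂ i z = σ₂ j z' → i = j ∧ z = z')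
    (hcancel : ∀ w : Y₂, (¬ ∃ i ∈ Γ, ∃ z ∈ X₂, σ₂ i z = w) → ∀ y : Y₃, ∑ i ∈ Γ, s i * N w (σ₃ i y) = 0)
    (M : Matrix Y₁ Y₂ R) (x : Y₁) (y : Y₃) :
    ∑ z ∈ X₂, foldK Γ σ₂ s M x z * foldK Γ σ₃ s N z y = foldK Γ σ₃ s (M * N) x y := by
  classical
  -- the image of `Γ × X₂` in the middle carrier
  set Im : Finset Y₂ := (Γ ×ˢ X₂).image (fun p => σ₂ p.1 p.2) with hIm
  have hinj : Set.InjOn (fun p : ι × Y₂ => σ₂ p.1 p.2) ↑(Γ ×ˢ X₂) := by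
    rintro ⟨i, z⟩ hp ⟨j, z'⟩ hp' h
    rw [Finset.coe_product] at hp hp'
    obtain ⟨hi, hz⟩ := hp
    obtain ⟨hj, hz'⟩ := hp'
    obtain ⟨h1, h2⟩ := htile i hi j hj z hz z' hz' h
    rw [h1, h2]
  -- step 1: expand and use the invariance of `N` under the image index of the left factor, then the closure and the reindexing `j ↦ mul i j`
  have step1 : ∀ z ∈ X₂, foldK Γ σ₂ s M x z * foldK Γ σ₃ s N z y =
      ∑ i ∈ Γ, ∑ k ∈ Γ, s k * (M x (σ₂ i z) * N (σ₂ i z) (σ₃ k y)) := by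
    intro z _
    rw [foldK_apply, foldK_apply, Finset.sum_mul_sum]
    refine Finset.sum_congr rfl fun i hi => ?_
    -- reindex the inner sum along the bijection `mul i`
    have hreidx : ∑ j ∈ Γ, s i * M x (σ₂ i z) * (s j * N z (σ₃ j y)) = ∑ j ∈ Γ, s (mul i j) * (M x (σ₂ i z) * N (σ₂ i z) (σ₃ (mul i j) y)) := by
      refine Finset.sum_congr rfl fun j hj => ?_
      rw [hs i hi j hj, hσ₃ i hi j hj, Equiv.Perm.mul_apply, hN i hi]
      ring
    rw [hreidx]
    exact Finset.sum_nbij (mul i) (fun j hj => hmem i hi j hj) ((hbij i hi).injOn) ((hbij i hi).surjOn) (fun j _ => rfl)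
  rw [Finset.sum_congr rfl step1]
  -- now the sum over `(i, z)` is a sum over the image `Im`
  have step2 : ∀ k ∈ Γ, ∑ i ∈ Γ, ∑ z ∈ X₂, s k * (M x (σ₂ i z) * N (σ₂ i z) (σ₃ k y)) = s k * ∑ w ∈ Im, M x w * N w (σ₃ k y) := by
    intro k _
    rw [Finset.mul_sum, hIm, Finset.sum_image hinj, Finset.sum_product]
  have e3 : ∑ z ∈ X₂, ∑ i ∈ Γ, ∑ k ∈ Γ, s k * (M x (σ₂ i z) * N (σ₂ i z) (σ₃ k y)) =
      ∑ k ∈ Γ, ∑ i ∈ Γ, ∑ z ∈ X₂, s k * (M x (σ₂ i z) * N (σ₂ i z) (σ₃ k y)) := by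
    calc ∑ z ∈ X₂, ∑ i ∈ Γ, ∑ k ∈ Γ, s k * (M x (σ₂ i z) * N (σ₂ i z) (σ₃ k y))
        = ∑ z ∈ X₂, ∑ k ∈ Γ, ∑ i ∈ Γ, s k * (M x (σ₂ i z) * N (σ₂ i z) (σ₃ k y)) :=
          Finset.sum_congr rfl fun z _ => Finset.sum_comm
      _ = ∑ k ∈ Γ, ∑ z ∈ X₂, ∑ i ∈ Γ, s k * (M x (σ₂ i z) * N (σ₂ i z) (σ₃ k y)) := Finset.sum_comm
      _ = ∑ k ∈ Γ, ∑ i ∈ Γ, ∑ z ∈ X₂, s k * (M x (σ₂ i z) * N (σ₂ i z) (σ₃ k y)) :=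
          Finset.sum_congr rfl fun k _ => Finset.sum_comm
  rw [e3, Finset.sum_congr rfl step2]
  -- the complement of the image contributes nothing (mirror cancellation)
  have step4 : ∀ k ∈ Γ, ∑ w ∈ Im, M x w * N w (σ₃ k y) = (M * N) x (σ₃ k y) - ∑ w ∈ Imᶜ, M x w * N w (σ₃ k y) := by
    intro k _
    rw [Matrix.mul_apply, eq_sub_iff_add_eq, Finset.sum_add_sum_compl]
  rw [Finset.sum_congr rfl fun k hk => by rw [step4 k hk, mul_sub], Finset.sum_sub_distrib, foldK_apply]
  have hzero : ∑ k ∈ Γ, s k * ∑ w ∈ Imᶜ, M x w * N w (σ₃ k y) = 0 := by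
    have e : ∑ k ∈ Γ, s k * ∑ w ∈ Imᶜ, M x w * N w (σ₃ k y) = ∑ w ∈ Imᶜ, M x w * ∑ k ∈ Γ, s k * N w (σ₃ k y) := by
      simp_rw [Finset.mul_sum]
      rw [Finset.sum_comm]
      refine Finset.sum_congr rfl fun w _ => Finset.sum_congr rfl fun k _ => by ring
    rw [e]
    refine Finset.sum_eq_zero fun w hw => ?_
    have hw' : ¬ ∃ i ∈ Γ, ∃ z ∈ X₂, σ₂ i z = w := by
      rintro ⟨i, hi, z, hz, hizw⟩
      rw [Finset.mem_compl] at hw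
      exact hw (Finset.mem_image.2 ⟨(i, z), Finset.mem_product.2 ⟨hi, hz⟩, hizw⟩)
    rw [hcancel w hw' y, mul_zero]
  rw [hzero, sub_zero]

end Mul

/-! ## §3  The fold of the identity, and the compressed fold of an inverse -/

section Inverse

variable [CommRing R] [Fintype Y₂] [DecidableEq Y₂]

omit [Fintype Y₂] in
/-- ★ **THE FOLD OF THE IDENTITY IS THE IDENTITY ON THE INTERIOR** (freeness: a non-trivially indexed image of an interior point is never interior; `σ_e = 1`, `s_e = 1`).
[cite: Balaban1983RegularityDecay, (2.42) p.584, bookkeeping] -/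
theorem foldK_one_apply (Γ : Finset ι) (σ : ι → Equiv.Perm Y₂) (s : ι → R) (X : Finset Y₂) {e : ι} (he : e ∈ Γ) (hσe : σ e = 1) (hse : s e = 1)
    (hfree : ∀ i ∈ Γ, i ≠ e → ∀ y ∈ X, σ i y ∉ X) {x y : Y₂} (hx : x ∈ X) (hy : y ∈ X) :
    foldK Γ σ s (1 : Matrix Y₂ Y₂ R) x y = if x = y then 1 else 0 := by
  classical
  rw [foldK_apply, ← Finset.add_sum_erase Γ _ he, hσe, hse, Equiv.Perm.one_apply, Matrix.one_apply, one_mul]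
  have h0 : ∑ i ∈ Γ.erase e, s i * (1 : Matrix Y₂ Y₂ R) x (σ i y) = 0 := by
    refine Finset.sum_eq_zero fun i hi => ?_
    obtain ⟨hne, hiΓ⟩ := Finset.mem_erase.1 hi
    have hxy : x ≠ σ i y := fun h => hfree i hiΓ hne y hy (h ▸ hx)
    rw [Matrix.one_apply_ne hxy, mul_zero]
  rw [h0, add_zero]

/-- ★★ **THE COMPRESSED FOLDS MULTIPLY**: `fold(M)|_{X₁×X₂} · fold(N)|_{X₂×X₃} = fold(M·N)|_{X₁×X₃}` (§2 read as a product of compressions).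
[cite: Balaban1983RegularityDecay, (2.42) p.584; Balaban1985BackgroundPropagators, p.394, (3.25) p.394] -/
theorem compress_foldK_mul (Γ : Finset ι) (s : ι → R) (σ₂ : ι → Equiv.Perm Y₂) (σ₃ : ι → Equiv.Perm Y₃) (mul : ι → ι → ι)
    (X₁ : Finset Y₁) (X₂ : Finset Y₂) (X₃ : Finset Y₃)
    (hmem : ∀ i ∈ Γ, ∀ j ∈ Γ, mul i j ∈ Γ) (hσ₃ : ∀ i ∈ Γ, ∀ j ∈ Γ, σ₃ (mul i j) = σ₃ i * σ₃ j) (hs : ∀ i ∈ Γ, ∀ j ∈ Γ, s (mul i j) = s i * s j)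
    (hbij : ∀ i ∈ Γ, Set.BijOn (mul i) ↑Γ ↑Γ)
    {N : Matrix Y₂ Y₃ R} (hN : ∀ i ∈ Γ, ∀ u w, N (σ₂ i u) (σ₃ i w) = N u w)
    (htile : ∀ i ∈ Γ, ∀ j ∈ Γ, ∀ z ∈ X₂, ∀ z' ∈ X₂, σ₂ i z = σ₂ j z' → i = j ∧ z = z')
    (hcancel : ∀ w : Y₂, (¬ ∃ i ∈ Γ, ∃ z ∈ X₂, σ₂ i z = w) → ∀ y : Y₃, ∑ i ∈ Γ, s i * N w (σ₃ i y) = 0)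
    (M : Matrix Y₁ Y₂ R) :
    (foldK Γ σ₂ s M).submatrix (fun v : ↥X₁ => (v : Y₁)) (fun v : ↥X₂ => (v : Y₂)) *
        (foldK Γ σ₃ s N).submatrix (fun v : ↥X₂ => (v : Y₂)) (fun v : ↥X₃ => (v : Y₃)) =
      (foldK Γ σ₃ s (M * N)).submatrix (fun v : ↥X₁ => (v : Y₁)) (fun v : ↥X₃ => (v : Y₃)) := by
  ext x y
  rw [Matrix.mul_apply]
  simp only [Matrix.submatrix_apply]
  rw [← sum_foldK_mul_foldK Γ s σ₂ σ₃ mul X₂ hmem hσ₃ hs hbij hN htile hcancel M (x : Y₁) (y : Y₃)]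
  exact (Finset.sum_coe_sort X₂ (fun z => foldK Γ σ₂ s M x z * foldK Γ σ₃ s N z y))

/-- ★★★ **THE COMPRESSION OF A FOLDED LETTER IS INVERTED BY THE COMPRESSED FOLD OF ITS INVERSE**: if `A·G = 1` on the covering carrier, `G` is jointly invariant, the
images of the interior tile the free points, the mirror rows of `G` cancel and the images are free, then `fold(A)|_{X×X} · fold(G)|_{X×X} = 1`.
[cite: Balaban1983RegularityDecay, (2.42) p.584 («Using this representation it is enough to prove (2.35), (2.36) for the propagator G_j»); Balaban1985BackgroundPropagators, p.394, Thm 3.2 p.398, p.409 l.1–5] -/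
theorem compress_foldK_mul_compress_foldK_eq_one (Γ : Finset ι) (s : ι → R) (σ : ι → Equiv.Perm Y₂) (mul : ι → ι → ι) (X : Finset Y₂)
    (hmem : ∀ i ∈ Γ, ∀ j ∈ Γ, mul i j ∈ Γ) (hσ : ∀ i ∈ Γ, ∀ j ∈ Γ, σ (mul i j) = σ i * σ j) (hs : ∀ i ∈ Γ, ∀ j ∈ Γ, s (mul i j) = s i * s j)
    (hbij : ∀ i ∈ Γ, Set.BijOn (mul i) ↑Γ ↑Γ)
    {e : ι} (he : e ∈ Γ) (hσe : σ e = 1) (hse : s e = 1) (hfree : ∀ i ∈ Γ, i ≠ e → ∀ y ∈ X, σ i y ∉ X)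
    {A G : Matrix Y₂ Y₂ R} (hAG : A * G = 1) (hG : ∀ i ∈ Γ, ∀ u w, G (σ i u) (σ i w) = G u w)
    (htile : ∀ i ∈ Γ, ∀ j ∈ Γ, ∀ z ∈ X, ∀ z' ∈ X, σ i z = σ j z' → i = j ∧ z = z')
    (hcancel : ∀ w : Y₂, (¬ ∃ i ∈ Γ, ∃ z ∈ X, σ i z = w) → ∀ y : Y₂, ∑ i ∈ Γ, s i * G w (σ i y) = 0) :
    (foldK Γ σ s A).submatrix (fun v : ↥X => (v : Y₂)) (fun v : ↥X => (v : Y₂)) *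
        (foldK Γ σ s G).submatrix (fun v : ↥X => (v : Y₂)) (fun v : ↥X => (v : Y₂)) = 1 := by
  rw [compress_foldK_mul Γ s σ σ mul X X X hmem hσ hs hbij hG htile hcancel A, hAG]
  ext x y
  simp only [Matrix.submatrix_apply]
  rw [foldK_one_apply Γ σ s X he hσe hse hfree x.2 y.2, Matrix.one_apply]
  simp only [Subtype.ext_iff]

/-- ★ hence the compression of the folded letter is a unit … [cite: Balaban1985BackgroundPropagators, p.394, Thm 3.2 p.398; Balaban1983RegularityDecay, (2.42) p.584] -/
theorem isUnit_compress_foldK (Γ : Finset ι) (s : ι → R) (σ : ι → Equiv.Perm Y₂) (mul : ι → ι → ι) (X : Finset Y₂)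
    (hmem : ∀ i ∈ Γ, ∀ j ∈ Γ, mul i j ∈ Γ) (hσ : ∀ i ∈ Γ, ∀ j ∈ Γ, σ (mul i j) = σ i * σ j) (hs : ∀ i ∈ Γ, ∀ j ∈ Γ, s (mul i j) = s i * s j)
    (hbij : ∀ i ∈ Γ, Set.BijOn (mul i) ↑Γ ↑Γ)
    {e : ι} (he : e ∈ Γ) (hσe : σ e = 1) (hse : s e = 1) (hfree : ∀ i ∈ Γ, i ≠ e → ∀ y ∈ X, σ i y ∉ X)
    {A G : Matrix Y₂ Y₂ R} (hAG : A * G = 1) (hG : ∀ i ∈ Γ, ∀ u w, G (σ i u) (σ i w) = G u w)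
    (htile : ∀ i ∈ Γ, ∀ j ∈ Γ, ∀ z ∈ X, ∀ z' ∈ X, σ i z = σ j z' → i = j ∧ z = z')
    (hcancel : ∀ w : Y₂, (¬ ∃ i ∈ Γ, ∃ z ∈ X, σ i z = w) → ∀ y : Y₂, ∑ i ∈ Γ, s i * G w (σ i y) = 0) :
    IsUnit ((foldK Γ σ s A).submatrix (fun v : ↥X => (v : Y₂)) (fun v : ↥X => (v : Y₂))) := by
  have h := compress_foldK_mul_compress_foldK_eq_one Γ s σ mul X hmem hσ hs hbij he hσe hse hfree hAG hG htile hcancel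
  exact ⟨⟨_, _, h, mul_eq_one_comm.1 h⟩, rfl⟩

/-- ★ … with inverse the compressed fold of the inverse: `(fold(A)|_{X×X})⁻¹ = fold(G)|_{X×X}`.
[cite: Balaban1985BackgroundPropagators, p.394 («Its inverse»), Thm 3.2 p.398, p.409 l.1–5; Balaban1983RegularityDecay, (2.42) p.584] -/
theorem inv_compress_foldK (Γ : Finset ι) (s : ι → R) (σ : ι → Equiv.Perm Y₂) (mul : ι → ι → ι) (X : Finset Y₂)
    (hmem : ∀ i ∈ Γ, ∀ j ∈ Γ, mul i j ∈ Γ) (hσ : ∀ i ∈ Γ, ∀ j ∈ Γ, σ (mul i j) = σ i * σ j) (hs : ∀ i ∈ Γ, ∀ j ∈ Γ, s (mul i j) = s i * s j)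
    (hbij : ∀ i ∈ Γ, Set.BijOn (mul i) ↑Γ ↑Γ)
    {e : ι} (he : e ∈ Γ) (hσe : σ e = 1) (hse : s e = 1) (hfree : ∀ i ∈ Γ, i ≠ e → ∀ y ∈ X, σ i y ∉ X)
    {A G : Matrix Y₂ Y₂ R} (hAG : A * G = 1) (hG : ∀ i ∈ Γ, ∀ u w, G (σ i u) (σ i w) = G u w)
    (htile : ∀ i ∈ Γ, ∀ j ∈ Γ, ∀ z ∈ X, ∀ z' ∈ X, σ i z = σ j z' → i = j ∧ z = z')
    (hcancel : ∀ w : Y₂, (¬ ∃ i ∈ Γ, ∃ z ∈ X, σ i z = w) → ∀ y : Y₂, ∑ i ∈ Γ, s i * G w (σ i y) = 0) :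
    ((foldK Γ σ s A).submatrix (fun v : ↥X => (v : Y₂)) (fun v : ↥X => (v : Y₂)))⁻¹ =
      (foldK Γ σ s G).submatrix (fun v : ↥X => (v : Y₂)) (fun v : ↥X => (v : Y₂)) :=
  Matrix.inv_eq_right_inv (compress_foldK_mul_compress_foldK_eq_one Γ s σ mul X hmem hσ hs hbij he hσe hse hfree hAG hG htile hcancel)

end Inverse

/-! ## §4  The decay fold (rectangular) -/

section Decay

variable [Fintype Y₂]

omit [Fintype Y₂] in
/-- ★ **THE DECAY FOLD**: if `|s_i| ≤ 1`, `|G u w| ≤ c u · φ (d′ u w)` with `φ` antitone and nonnegative `c`, and the target distance does not exceed the covering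
distance to any image (`d x y ≤ d′ x (σ_i y)`), then `|fold(G) x y| ≤ #Γ · c x · φ (d x y)`.
[cite: Balaban1983RegularityDecay, (2.42) p.584 («it is enough to prove (2.35), (2.36) for the propagator G_j»); Balaban1985BackgroundPropagators, Thm 3.2 (3.48) p.398] -/
theorem abs_foldK_le_of_antitone (Γ : Finset ι) (σ : ι → Equiv.Perm Y₂) (s : ι → ℝ) (G : Matrix Y₁ Y₂ ℝ)
    (hs : ∀ i ∈ Γ, |s i| ≤ 1) {c : Y₁ → ℝ} (hc : ∀ u, 0 ≤ c u) {φ : ℝ → ℝ} (hφ : Antitone φ)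
    {d' : Y₁ → Y₂ → ℝ} {dX : Y₁ → Y₂ → ℝ} (hG : ∀ u w, |G u w| ≤ c u * φ (d' u w))
    (x : Y₁) (y : Y₂) (hd : ∀ i ∈ Γ, dX x y ≤ d' x (σ i y)) :
    |foldK Γ σ s G x y| ≤ Γ.card * (c x * φ (dX x y)) := by
  rw [foldK_apply]
  refine (Finset.abs_sum_le_sum_abs _ _).trans ?_
  have hterm : ∀ i ∈ Γ, |s i * G x (σ i y)| ≤ c x * φ (dX x y) := by
    intro i hi
    rw [abs_mul]
    have h1 : |G x (σ i y)| ≤ c x * φ (dX x y) :=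
      (hG x (σ i y)).trans (mul_le_mul_of_nonneg_left (hφ (hd i hi)) (hc x))
    have h0 : 0 ≤ c x * φ (dX x y) := le_trans (abs_nonneg _) h1
    calc |s i| * |G x (σ i y)| ≤ 1 * (c x * φ (dX x y)) := mul_le_mul (hs i hi) h1 (abs_nonneg _) zero_le_one
      _ = c x * φ (dX x y) := one_mul _
  calc ∑ i ∈ Γ, |s i * G x (σ i y)| ≤ ∑ i ∈ Γ, c x * φ (dX x y) := Finset.sum_le_sum hterm
    _ = Γ.card * (c x * φ (dX x y)) := by rw [Finset.sum_const, nsmul_eq_mul]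

end Decay

end Literature.MathematicalPhysics.QuantumFieldTheory.Balaban1983to89.B4Eq242SignedImagesFold
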